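import Literature.NumberTheory.Automorphic.SymplecticBorelUnipotentRadical
import HarnessLib

/-!
# The modulus index of the Borel subgroup of `Sp_{2n}` evaluated: `[B(𝒪) : B(𝒪) ∩ t_μB(𝒪)t_μ⁻¹] = q^{-2⟨ρ,μ⟩}`
# (`μ` antidominant), the index ratio `q^{2⟨ρ,μ⟩}` for every `μ`, and the `w₀`-invariance of the Satake transform
# `𝒮_q` of `ℋ(Sp_{2n}(K), Sp_{2n}(𝒪); R)` for every `n` (Cartier §IV (4.2); Macdonald V (2.6)–(2.9); Laumon (4.1.4))

Topic `NumberTheory/Automorphic`; namespace `Literature.NumberTheory.Automorphic.SymplecticCartan` (lane `lit-hodgefound`,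
Track 2 foundations; seat `lit-hodgefound-p11`, generation 45, row g45-#4).  THEOREMS ONLY: no definition, no named fact, no
instance, no notation.  Sequel of `SubgroupIndexDevissage` (g45-#1: the dévissage `[A' : A] = [Q' : Q]·[N' : N]` and the
coordinate count `[ϖ^{-a}𝒪 : ϖ^{-b}𝒪] = q^{(a-b)⁺}`), `SymplecticBorelUnipotentRadical` (g45-#3: the root-group coordinates
`N(ν)`, `X_k(ν)` of the unipotent radical `U` of the Borel `B ≤ Sp_{2n}`, generation `U(𝒪) = N(0) ⊔ ⨆_k X_k(0)`, the weight
shift `t_μU(𝒪)t_μ⁻¹ = N(μ) ⊔ ⨆_k X_k(μ)`, normalisation, disjointness, torus removal) and `SymplecticSatakeTransformDuality`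
(g44-#4: the duality `#{a γ = μ}·[t_μK_Pt_μ⁻¹ : K_P ∩ t_μK_Pt_μ⁻¹] = #{a γ = -μ}·[K_P : K_P ∩ t_μK_Pt_μ⁻¹]` with the indices
left abstract).  Here the indices are EVALUATED and the consequences drawn for every `n`.

## The mathematics

Let `K` be a field with a discrete valuation `v : K → ℤᵐ⁰`, finite residue field `𝓀` of cardinality `q`, uniformiser `ϖ`;
`K₀ = Sp_{2n}(𝒪)`, `B(K)` the Borel subgroup of the tree (lower block-triangular in the `(inl, inr)` display), `K_P = B(𝒪)`,
`t_μ = diag(ϖ^μ; ϖ^{-μ})` (`μ ∈ ℤⁿ`), `⟨ρ, μ⟩ = Σ_i (n - i) μ_i` (`symplecticRhoPairing`, `0`-based `i`).  For `μ` ANTIDOMINANT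
for this Borel (`μ` monotone, `μ ≤ 0`) one has `t_μB(𝒪)t_μ⁻¹ ≤ B(𝒪)` and

  `[B(𝒪) : t_μB(𝒪)t_μ⁻¹] = [U(𝒪) : t_μU(𝒪)t_μ⁻¹] = ∏_j ∏_{a<j} q^{μ_j-μ_a} · ∏_{a≤b} q^{-μ_a-μ_b} = q^{-2⟨ρ,μ⟩}`     (※)

(Macdonald V (2.6)/(2.9): `δ_B(t) = ∏_{α>0} |α(t)|`; Cartier §I.3, §IV (4.2); Laumon (4.1.4)).  PROOF.  (i) Torus removal
(g45-#3): `B(𝒪) = U(𝒪)·T(𝒪)` with `T(𝒪) ⊆ t_μB(𝒪)t_μ⁻¹`, so `[B(𝒪) : B(𝒪) ∩ t_μB(𝒪)t_μ⁻¹] = [U(𝒪) : U(𝒪) ∩ t_μU(𝒪)t_μ⁻¹]`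
(`relIndex_eq_relIndex_of_coe_subset_mul`).  (ii) `U(𝒪) = U(0)`, `t_μU(𝒪)t_μ⁻¹ = U(μ) ≤ U(0)` where
`U(ν) = N(ν) ⊔ ⨆_k X_k(ν)`.  (iii) DÉVISSAGE along the chain `X_0 ⊲ X_0X_1 ⊲ ⋯ ⊲ ∏_{j<k} X_j ⊲ ⋯ ⊲ ∏_j X_j ⊲ U`: at each
step `A' = Q'N'`, `A = QN` with `Q'` normalising `N'`, `Q' ∩ N' = 1`, `(QN) ∩ N' = N`, so `[A' : A] = [Q' : Q]·[N' : N]`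
(g45-#1), and `[X_k(0) : X_k(μ)] = ∏_{a<k} q^{μ_k - μ_a}`, `[N(0) : N(μ)] = ∏_{a≤b} q^{-μ_a-μ_b}` because the coordinate maps
`c ↦ m(1 + N_k(c))`, `c ↦ u(S(c))` are homomorphisms from boxes `∏ ϖ^{-r}𝒪` whose kernels lie in every box, and
`[∏ C_i : ∏ B_i] = ∏ [C_i : B_i]` (`relIndex_pi_univ`).  (iv) The exponent: `Σ_j Σ_{a<j} (μ_j-μ_a) + Σ_{a≤b} (-μ_a-μ_b) = -2⟨ρ,μ⟩`
(coefficient of `μ_i`: `i - (n-1-i) - (n-i) - (i+1) = -2(n-i)`).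
CONSEQUENCES.  (a) For EVERY `μ ∈ ℤⁿ` the RATIO of the two indices is the modulus:
`[t_μK_Pt_μ⁻¹ : K_P ∩ t_μK_Pt_μ⁻¹]·q^{(-2⟨ρ,μ⟩)⁺} = [K_P : K_P ∩ t_μK_Pt_μ⁻¹]·q^{(2⟨ρ,μ⟩)⁺}` — by (※) at `λ` and `μ + λ` for an
antidominant `λ` making `μ + λ` antidominant, and the multiplicativity of the ratio (g44-#1 `relIndex_conj_mul_conj`).
(b) COUNTING DUALITY WITH `q` EXPLICIT: `#{γ ∈ K₀gK₀/K₀ : a γ = μ}·q^{(2⟨ρ,μ⟩)⁺} = #{γ : a γ = -μ}·q^{(-2⟨ρ,μ⟩)⁺}`; the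
dominant-extreme count `#{γ ∈ K₀d(a)K₀/K₀ : a γ = -a} = q^{2⟨ρ,a⟩}` (`a ∈ ℕⁿ` antitone; Macdonald's leading term).
(c) THE `w₀`-INVARIANCE OF THE SATAKE TRANSFORM for every `n`: if `q ∈ Rˣ` is the residue cardinality then
`𝒮_q(T)_{-μ} = 𝒮_q(T)_μ` for every `T ∈ ℋ(Sp_{2n}(K), K₀; R)` and every `μ` (`𝒮_q(T_g)_μ = #{a γ = μ} q^{⟨ρ,μ⟩}` and (b), then
linearity), i.e. `ι(𝒮_q T) = 𝒮_q T` for the antipode `ι(x^μ) = x^{-μ}`: Cartier's Theorem 4.1 / Satake's `W`-invariance for the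
longest element `w₀ = -1 ∈ W(C_n)` (the rank-one case is g45-#2).

## What is formalised

* §1 `relIndex_pi_univ` (`[∏ C_i : ∏ B_i] = ∏ [C_i : B_i]` for additive subgroups of a finite product).
* §2 `relIndex_leviColumnBall`, `relIndex_siegelLowerBall` (ball indices as powers of `q`).
* §3 `leviColumnBall_le_leviColumnBall_zero`, `siegelLowerBall_le_siegelLowerBall_zero`, **`relIndex_biSup_leviColumnBall_eq_pow`**
  (the Levi chain, induction on `k`), **`relIndex_unipotentBall_eq_pow`** (`[U(0) : U(μ)]`).
* §4 `relIndex_conjAct_borelInt_eq_relIndex_unipotentInt` (torus removal, every `μ`), **`relIndex_conjAct_borelInt_eq_pow_sum`**,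
  `relIndex_borelInt_conjAct_eq_one`.
* §5 `symplecticRhoPairing_neg`, `symplecticRhoPairing_nonpos`, **`sum_sub_add_sum_neg_eq_neg_two_mul_symplecticRhoPairing`**,
  `sum_toNat_add_sum_toNat_eq`.
* §6 **`relIndex_conjAct_borelInt_eq_pow`** (※), `relIndex_borelInt_conjAct_eq_pow` (dominant form `q^{2⟨ρ,μ⟩}`),
  `relIndex_conjAct_borelInt_eq_one`, **`card_filter_symplecticIwasawaExp_orbit_neg_eq_pow`**.
* §7 `coe_mul_eq_diagonal_zpow_add`, **`relIndex_borelInt_conjAct_mul_pow_eq`** (a), **`card_filter_symplecticIwasawaExp_mul_pow_eq`** (b).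
* §8 `coeff_symplecticSatakeTransform_doubleCosetOperator_neg`, **`coeff_symplecticSatakeTransform_neg`**,
  **`domCongr_neg_symplecticSatakeTransform`**, `range_symplecticSatakeTransform_subset` (c).
* §9 `coeff_satakeTransform_one_eq_mul_pow_symplectic` (`𝒮_1(T)_μ = 𝒮_1(T)_{-μ} q^{-2⟨ρ,μ⟩}`, `μ` antidominant),
  **`coeff_satakeTransform_one_mul_pow_eq_symplectic`** (`𝒮_1(T)_μ q^{(2⟨ρ,μ⟩)⁺} = 𝒮_1(T)_{-μ} q^{(-2⟨ρ,μ⟩)⁺}`, all `μ`, all `R`).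

## References
* [CartierCorvallis1979] P. Cartier, *Representations of 𝔭-adic groups: a survey*, PSPM 33.1 (1979), §I.3 (commensurable
  compact open subgroups, `μ(KgK)/μ(K)`), §IV (4.2) (`δ(m)^{1/2}`, the Satake transform), Thm. 4.1.
* [Macdonald1995] I. G. Macdonald, *Symmetric Functions and Hall Polynomials*, 2nd ed. (1995), Ch. V (2.6)–(2.9) (`δ(t)` as a
  product over the positive roots, the leading term `q^{⟨λ,2ρ⟩}`), (3.4).
* [Laumon1995] G. Laumon, *Cohomology of Drinfeld Modular Varieties I*, CUP (1996), (4.1.3)–(4.1.6).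
* [BruhatTits1972] F. Bruhat, J. Tits, *Groupes réductifs sur un corps local I*, Publ. Math. IHÉS 41 (1972), Prop. (4.4.4),
  §6.1 (root-group filtrations, concave functions).
* [AndrianovZhuravlev1995] A. N. Andrianov, V. G. Zhuravlev, *Modular Forms and Hecke Operators*, Transl. Math. Monogr. 145
  (1995), Ch. 3 §3 Lemma 3.4, Lemma 3.6, §3.3 (3.44)–(3.49), Thm. 3.30.
* [Satake1963] I. Satake, *Theory of spherical functions on reductive algebraic groups over 𝔭-adic fields*, Publ. Math. IHÉS
  18 (1963), §§6–7.
-/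

noncomputable section

open scoped Valued WithZero Pointwise
open Matrix MulAction ConjAct

namespace Literature.NumberTheory.Automorphic.SymplecticCartan

open Literature.NumberTheory.Automorphic.CartanUnique Literature.NumberTheory.Automorphic.HermitianLattice

variable {K : Type*} [Field K] {n : ℕ}

/-! ## §1 The index of a product of subgroups is the product of the indices -/

section PiIndex

/-- Dependent-product version of Mathlib's `AddSubgroup.index_pi`. [folklore] -/
private theorem index_pi_dep {ι : Type*} [Fintype ι] {A : ι → Type*} [∀ i, AddGroup (A i)] (H : ∀ i, AddSubgroup (A i)) :
    (AddSubgroup.pi Set.univ H).index = ∏ i, (H i).index := by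
  simp_rw [AddSubgroup.index, ← Nat.card_pi]
  refine Nat.card_congr ((Quotient.congrRight fun x y => ?_).trans (Setoid.piQuotientEquiv _).symm)
  rw [QuotientAddGroup.leftRel_pi]

/-- **`[∏ᵢ Cᵢ : ∏ᵢ Bᵢ] = ∏ᵢ [Cᵢ : Bᵢ]`** for families of additive subgroups `Bᵢ, Cᵢ ≤ A` indexed by a finite type: the
relative index of coordinate boxes is the product of the coordinate indices (the quotient `∏ Cᵢ / ∏ (Bᵢ ∩ Cᵢ)` is the
product of the `Cᵢ/(Bᵢ ∩ Cᵢ)`).  The counting engine for root-group coordinates. [cite: CartierCorvallis1979, §I.3]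
[cite: Macdonald1995, Ch. V (2.6)] -/
theorem relIndex_pi_univ {ι : Type*} [Fintype ι] {A : Type*} [AddGroup A] (B C : ι → AddSubgroup A) :
    (AddSubgroup.pi Set.univ B).relIndex (AddSubgroup.pi Set.univ C) = ∏ i, (B i).relIndex (C i) := by
  let Φ : (∀ i, C i) →+ (ι → A) :=
    { toFun := fun x i => (x i : A), map_zero' := rfl, map_add' := fun _ _ => rfl }
  have hrange : AddSubgroup.pi Set.univ C = (⊤ : AddSubgroup (∀ i, C i)).map Φ := by
    ext x
    simp only [AddSubgroup.mem_pi, Set.mem_univ, true_imp_iff, AddSubgroup.mem_map, AddSubgroup.mem_top, true_and]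
    constructor
    · intro hx
      exact ⟨fun i => ⟨x i, hx i⟩, rfl⟩
    · rintro ⟨y, rfl⟩ i
      exact (y i).2
  have hcomap : (AddSubgroup.pi Set.univ B).comap Φ = AddSubgroup.pi Set.univ fun i => (B i).addSubgroupOf (C i) := by
    ext y
    simp only [AddSubgroup.mem_comap, AddSubgroup.mem_pi, Set.mem_univ, true_imp_iff, AddSubgroup.mem_addSubgroupOf]
    rfl
  rw [hrange, ← AddSubgroup.relIndex_comap, AddSubgroup.relIndex_top_right, hcomap, index_pi_dep]
  rfl

end PiIndex

/-! ## §2 The indices of the root-group balls: `[X_κ(ν') : X_κ(ν)]`, `[N(ν') : N(ν)]` as powers of `q` -/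

section BallIndex

variable [Valued K ℤᵐ⁰] {ϖ : K}

/-- The kernel of the column parametrisation `m(1 + N_κ(·))` (coordinates `a ≥ κ`) lies in every ball box. [folklore] -/
private theorem ker_leviColumnHom_le (κ : Fin n) (ν : Fin n → ℤ) :
    (leviColumnHom (K := K) κ).ker ≤ AddSubgroup.toSubgroup (AddSubgroup.pi Set.univ fun a : Fin n =>
      if a < κ then (Valued.v : Valuation K ℤᵐ⁰).leAddSubgroup (WithZero.exp (ν a - ν κ)) else ⊤) := by
  intro c hc
  rw [MonoidHom.mem_ker] at hc
  change Multiplicative.toAdd c ∈ AddSubgroup.pi Set.univ _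
  refine (AddSubgroup.mem_pi _).2 fun a _ => ?_
  by_cases ha : a < κ
  · rw [if_pos ha, apply_eq_zero_of_leviColumnHom_eq_one hc ha]
    exact AddSubgroup.zero_mem _
  · rw [if_neg ha]
    exact AddSubgroup.mem_top _

/-- The kernel of the Siegel parametrisation `u(S(·))` (coordinates `p.1 > p.2`) lies in every ball box. [folklore] -/
private theorem ker_siegelLowerHom_le (ν : Fin n → ℤ) :
    (siegelLowerHom n K).ker ≤ AddSubgroup.toSubgroup (AddSubgroup.pi Set.univ fun p : Fin n × Fin n =>
      if p.1 ≤ p.2 then (Valued.v : Valuation K ℤᵐ⁰).leAddSubgroup (WithZero.exp (ν p.1 + ν p.2)) else ⊤) := by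
  intro c hc
  rw [MonoidHom.mem_ker] at hc
  change Multiplicative.toAdd c ∈ AddSubgroup.pi Set.univ _
  refine (AddSubgroup.mem_pi _).2 fun p _ => ?_
  by_cases hp : p.1 ≤ p.2
  · rw [if_pos hp, show p = (p.1, p.2) from rfl, apply_eq_zero_of_siegelLowerHom_eq_one hc hp]
    exact AddSubgroup.zero_mem _
  · rw [if_neg hp]
    exact AddSubgroup.mem_top _

/-- **`[X_κ(ν') : X_κ(ν)] = q^{Σ_{a<κ} ((ν'_a - ν'_κ) - (ν_a - ν_κ))⁺}`**: the relative index of two balls of the `κ`-th Levi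
column group is the product over the roots `a < κ` of the indices `[ϖ^{-r'}𝒪 : ϖ^{-r}𝒪] = q^{(r' - r)⁺}` of the coordinate
balls (`SubgroupIndexDevissage.relIndex_leAddSubgroup_exp`). [cite: Macdonald1995, Ch. V (2.6)] [cite: CartierCorvallis1979, §I.3]
[cite: BruhatTits1972, §6.1] -/
theorem relIndex_leviColumnBall (hϖ : Valued.v ϖ = WithZero.exp (-1 : ℤ)) [Finite 𝓀[K]] (κ : Fin n) (ν ν' : Fin n → ℤ) :
    (leviColumnBall n K κ ν).relIndex (leviColumnBall n K κ ν') =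
      Nat.card 𝓀[K] ^ ∑ a ∈ Finset.Iio κ, ((ν' a - ν' κ) - (ν a - ν κ)).toNat := by
  rw [leviColumnBall, leviColumnBall, Subgroup.relIndex_map_map, sup_eq_left.2 (ker_leviColumnHom_le κ ν),
    sup_eq_left.2 (ker_leviColumnHom_le κ ν'), AddSubgroup.relIndex_toSubgroup, relIndex_pi_univ]
  have h : ∀ a : Fin n,
      (if a < κ then (Valued.v : Valuation K ℤᵐ⁰).leAddSubgroup (WithZero.exp (ν a - ν κ)) else ⊤ : AddSubgroup K).relIndex
          (if a < κ then (Valued.v : Valuation K ℤᵐ⁰).leAddSubgroup (WithZero.exp (ν' a - ν' κ)) else ⊤) =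
        if a < κ then Nat.card 𝓀[K] ^ ((ν' a - ν' κ) - (ν a - ν κ)).toNat else 1 := by
    intro a
    split_ifs with ha
    · exact relIndex_leAddSubgroup_exp hϖ _ _
    · exact AddSubgroup.relIndex_top_left _
  rw [Finset.prod_congr rfl fun a _ => h a, ← Finset.prod_filter, Finset.prod_pow_eq_pow_sum]
  congr 1
  refine Finset.sum_congr (by ext a; simp) fun _ _ => rfl

/-- **`[N(ν') : N(ν)] = q^{Σ_{a≤b} ((ν'_a + ν'_b) - (ν_a + ν_b))⁺}`**: the relative index of two balls of the Siegel lower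
group is the product over the roots `a ≤ b` of the coordinate indices. [cite: Macdonald1995, Ch. V (2.6)]
[cite: CartierCorvallis1979, §I.3] [cite: AndrianovZhuravlev1995, Ch. 3 §3 Lemma 3.4] -/
theorem relIndex_siegelLowerBall (hϖ : Valued.v ϖ = WithZero.exp (-1 : ℤ)) [Finite 𝓀[K]] (ν ν' : Fin n → ℤ) :
    (siegelLowerBall n K ν).relIndex (siegelLowerBall n K ν') =
      Nat.card 𝓀[K] ^ ∑ p ∈ Finset.univ.filter (fun p : Fin n × Fin n => p.1 ≤ p.2),
        ((ν' p.1 + ν' p.2) - (ν p.1 + ν p.2)).toNat := by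
  rw [siegelLowerBall, siegelLowerBall, Subgroup.relIndex_map_map, sup_eq_left.2 (ker_siegelLowerHom_le ν),
    sup_eq_left.2 (ker_siegelLowerHom_le ν'), AddSubgroup.relIndex_toSubgroup, relIndex_pi_univ]
  have h : ∀ p : Fin n × Fin n,
      (if p.1 ≤ p.2 then (Valued.v : Valuation K ℤᵐ⁰).leAddSubgroup (WithZero.exp (ν p.1 + ν p.2)) else ⊤ : AddSubgroup K).relIndex
          (if p.1 ≤ p.2 then (Valued.v : Valuation K ℤᵐ⁰).leAddSubgroup (WithZero.exp (ν' p.1 + ν' p.2)) else ⊤) =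
        if p.1 ≤ p.2 then Nat.card 𝓀[K] ^ ((ν' p.1 + ν' p.2) - (ν p.1 + ν p.2)).toNat else 1 := by
    intro p
    split_ifs with hp
    · exact relIndex_leAddSubgroup_exp hϖ _ _
    · exact AddSubgroup.relIndex_top_left _
  rw [Finset.prod_congr rfl fun p _ => h p, ← Finset.prod_filter, Finset.prod_pow_eq_pow_sum]

end BallIndex

/-! ## §3 The dévissage chain `X_0(ν) ⊲ X_0X_1(ν) ⊲ ⋯ ⊲ ∏_j X_j(ν) ⊲ U(ν)` and the index `[U(0) : U(μ)]` -/

section Chain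

/-- `(Q ⊔ N) ⊓ N' = N` when `N ≤ N'`, `Q` normalises `N` and `Q ∩ N' = 1`. [folklore] -/
private theorem sup_inf_eq_right_of_disjoint {G : Type*} [Group G] {Q N N' : Subgroup G} (hNN' : N ≤ N')
    (hQn : Q ≤ Subgroup.normalizer (N : Set G)) (hdisj : Q ⊓ N' = ⊥) : (Q ⊔ N) ⊓ N' = N := by
  refine le_antisymm (fun x hx => ?_) (le_inf le_sup_right hNN')
  obtain ⟨hxQN, hxN'⟩ := Subgroup.mem_inf.1 hx
  have hx' : x ∈ ((Q ⊔ N : Subgroup G) : Set G) := hxQN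
  rw [Subgroup.coe_mul_of_left_le_normalizer_right Q N hQn] at hx'
  obtain ⟨y, hy, m, hm, rfl⟩ := Set.mem_mul.1 hx'
  have hyN' : y ∈ N' := by
    have e : y = y * m * m⁻¹ := by rw [mul_inv_cancel_right]
    rw [e]
    exact N'.mul_mem hxN' (N'.inv_mem (hNN' hm))
  have hy1 : y = 1 := by
    rw [← Subgroup.mem_bot, ← hdisj]
    exact Subgroup.mem_inf.2 ⟨hy, hyN'⟩
  rw [hy1, one_mul]
  exact hm

/-- `⨆_{j<k+1} S_j = (⨆_{j<k} S_j) ⊔ S_k`. [folklore] -/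
private theorem biSup_lt_succ_eq {α : Type*} [CompleteLattice α] (S : Fin n → α) (k : ℕ) (hk : k < n) :
    (⨆ (j : Fin n) (_ : (j : ℕ) < k + 1), S j) = (⨆ (j : Fin n) (_ : (j : ℕ) < k), S j) ⊔ S ⟨k, hk⟩ := by
  refine le_antisymm (iSup₂_le fun j hj => ?_)
    (sup_le (iSup₂_le fun j hj => le_iSup₂_of_le j (Nat.lt_succ_of_lt hj) le_rfl)
      (le_iSup₂_of_le (⟨k, hk⟩ : Fin n) (Nat.lt_succ_self k) le_rfl))
  rcases Nat.lt_succ_iff_lt_or_eq.1 hj with h | h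
  · exact le_sup_of_le_left (le_iSup₂_of_le j h le_rfl)
  · obtain rfl : j = ⟨k, hk⟩ := Fin.ext h
    exact le_sup_right

variable [Valued K ℤᵐ⁰] {ϖ : K}

/-- The Levi column balls shrink with an antidominant shift: `X_j(μ) ≤ X_j(0)` for `μ` monotone. [cite: BruhatTits1972, §6.1] -/
theorem leviColumnBall_le_leviColumnBall_zero {μ : Fin n → ℤ} (hμ : Monotone μ) (j : Fin n) :
    leviColumnBall n K j μ ≤ leviColumnBall n K j (0 : Fin n → ℤ) :=
  leviColumnBall_mono fun a ha => by
    simp only [Pi.zero_apply, sub_zero]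
    linarith [hμ ha.le]

/-- The Siegel balls shrink with an antidominant shift: `N(μ) ≤ N(0)` for `μ ≤ 0`. [cite: BruhatTits1972, §6.1] -/
theorem siegelLowerBall_le_siegelLowerBall_zero {μ : Fin n → ℤ} (hμ0 : ∀ i, μ i ≤ 0) :
    siegelLowerBall n K μ ≤ siegelLowerBall n K (0 : Fin n → ℤ) :=
  siegelLowerBall_mono fun a => by simpa only [Pi.zero_apply] using hμ0 a

/-- **The Levi chain** `X_0 ⊲ X_0X_1 ⊲ ⋯`: for `μ` monotone and every `k ≤ n`,
`[∏_{j<k} X_j(0) : ∏_{j<k} X_j(μ)] = q^{Σ_{j<k} Σ_{a<j} (μ_j - μ_a)}` — dévissage (`SubgroupIndexDevissage`) along the normal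
chain with abelian coordinatised quotients `X_j(0)/X_j(μ)`. [cite: Macdonald1995, Ch. V (2.6)] [cite: BruhatTits1972, §6.1]
[cite: Laumon1995, (4.1.4)] -/
theorem relIndex_biSup_leviColumnBall_eq_pow (hϖ : Valued.v ϖ = WithZero.exp (-1 : ℤ)) [Finite 𝓀[K]] {μ : Fin n → ℤ}
    (hμ : Monotone μ) :
    ∀ k : ℕ, k ≤ n →
      (⨆ (j : Fin n) (_ : (j : ℕ) < k), leviColumnBall n K j μ).relIndex
          (⨆ (j : Fin n) (_ : (j : ℕ) < k), leviColumnBall n K j (0 : Fin n → ℤ)) =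
        Nat.card 𝓀[K] ^ ∑ j : Fin n, if (j : ℕ) < k then ∑ a ∈ Finset.Iio j, (μ j - μ a).toNat else 0
  | 0, _ => by
      have h0 : ∀ ν : Fin n → ℤ, (⨆ (j : Fin n) (_ : (j : ℕ) < 0), leviColumnBall n K j ν) = ⊥ := fun ν => by
        simp only [Nat.not_lt_zero, iSup_false, iSup_bot]
      rw [h0, h0, Subgroup.relIndex_self]
      simp only [Nat.not_lt_zero, if_false, Finset.sum_const_zero, pow_zero]
  | k + 1, hk => by
      have hkn : k < n := hk
      have IH := relIndex_biSup_leviColumnBall_eq_pow hϖ hμ k hkn.le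
      set κ : Fin n := ⟨k, hkn⟩ with hκ
      rw [biSup_lt_succ_eq _ k hkn, biSup_lt_succ_eq _ k hkn]
      have hQmono : (⨆ (j : Fin n) (_ : (j : ℕ) < k), leviColumnBall n K j μ) ≤
          ⨆ (j : Fin n) (_ : (j : ℕ) < k), leviColumnBall n K j (0 : Fin n → ℤ) :=
        iSup₂_mono fun j _ => leviColumnBall_le_leviColumnBall_zero hμ j
      have hXmono := leviColumnBall_le_leviColumnBall_zero (K := K) hμ κ
      have hQ'n : (⨆ (j : Fin n) (_ : (j : ℕ) < k), leviColumnBall n K j (0 : Fin n → ℤ)) ≤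
          Subgroup.normalizer (leviColumnBall n K κ (0 : Fin n → ℤ) : Set (symplecticGroup (Fin n) K)) :=
        iSup_leviColumnBall_le_normalizer_leviColumnBall κ 0
      have hQn : (⨆ (j : Fin n) (_ : (j : ℕ) < k), leviColumnBall n K j μ) ≤
          Subgroup.normalizer (leviColumnBall n K κ μ : Set (symplecticGroup (Fin n) K)) :=
        iSup_leviColumnBall_le_normalizer_leviColumnBall κ μ
      rw [relIndex_eq_mul_relIndex_of_devissage (sup_le_sup hQmono hXmono) le_sup_right le_sup_left
          (Subgroup.coe_mul_of_left_le_normalizer_right _ _ hQ'n).subset (sup_le hQ'n Subgroup.le_normalizer)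
          (Subgroup.coe_mul_of_left_le_normalizer_right _ _ hQn).subset le_sup_left
          (sup_inf_eq_right_of_disjoint hXmono hQn (iSup_leviColumnBall_inf_leviColumnBall_eq_bot κ μ 0)) hQmono
          (iSup_leviColumnBall_inf_leviColumnBall_eq_bot κ 0 0),
        IH, relIndex_leviColumnBall hϖ κ μ 0, ← pow_add]
      congr 1
      simp only [Pi.zero_apply, sub_zero, zero_sub, neg_sub]
      have hpt : ∀ j : Fin n, (if (j : ℕ) < k + 1 then ∑ a ∈ Finset.Iio j, (μ j - μ a).toNat else 0) =
          (if (j : ℕ) < k then ∑ a ∈ Finset.Iio j, (μ j - μ a).toNat else 0) +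
            if j = κ then ∑ a ∈ Finset.Iio j, (μ j - μ a).toNat else 0 := by
        intro j
        by_cases h1 : (j : ℕ) < k
        · have hne : j ≠ κ := fun h => by rw [h] at h1; exact lt_irrefl _ h1
          rw [if_pos (Nat.lt_succ_of_lt h1), if_pos h1, if_neg hne, add_zero]
        · by_cases h2 : j = κ
          · subst h2
            rw [if_pos (Nat.lt_succ_self k), if_neg h1, if_pos rfl, zero_add]
          · have h3 : ¬ (j : ℕ) < k + 1 := fun h => h2 (Fin.ext (by change (j : ℕ) = k; omega))
            rw [if_neg h3, if_neg h1, if_neg h2, add_zero]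
      rw [Finset.sum_congr rfl fun j _ => hpt j, Finset.sum_add_distrib, Fintype.sum_ite_eq']

/-- **`[U(0) : U(μ)] = q^{Σ_j Σ_{a<j} (μ_j - μ_a) + Σ_{a≤b} (-μ_a - μ_b)}`** for `μ` monotone `≤ 0`
(`U(ν) = N(ν) ⊔ ⨆_k X_k(ν)`): the last dévissage step `∏_j X_j ⊲ U` with quotient coordinatised by `N(0)/N(μ) ≅ ⊕_{a≤b}
𝒪/ϖ^{-μ_a-μ_b}𝒪`. [cite: Macdonald1995, Ch. V (2.6), (2.9)] [cite: Laumon1995, (4.1.4)] [cite: CartierCorvallis1979, §I.3] -/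
theorem relIndex_unipotentBall_eq_pow (hϖ : Valued.v ϖ = WithZero.exp (-1 : ℤ)) [Finite 𝓀[K]] {μ : Fin n → ℤ}
    (hμ : Monotone μ) (hμ0 : ∀ i, μ i ≤ 0) :
    (siegelLowerBall n K μ ⊔ ⨆ k : Fin n, leviColumnBall n K k μ).relIndex
        (siegelLowerBall n K (0 : Fin n → ℤ) ⊔ ⨆ k : Fin n, leviColumnBall n K k (0 : Fin n → ℤ)) =
      Nat.card 𝓀[K] ^ ((∑ j : Fin n, ∑ a ∈ Finset.Iio j, (μ j - μ a).toNat) +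
        ∑ p ∈ Finset.univ.filter (fun p : Fin n × Fin n => p.1 ≤ p.2), (-μ p.1 - μ p.2).toNat) := by
  have hfull : ∀ ν : Fin n → ℤ, (⨆ j : Fin n, leviColumnBall n K j ν) =
      ⨆ (j : Fin n) (_ : (j : ℕ) < n), leviColumnBall n K j ν := fun ν => by
    simp only [Fin.is_lt, iSup_pos]
  have hQmono : (⨆ j : Fin n, leviColumnBall n K j μ) ≤ ⨆ j : Fin n, leviColumnBall n K j (0 : Fin n → ℤ) :=
    iSup_mono fun j => leviColumnBall_le_leviColumnBall_zero hμ j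
  have hNmono := siegelLowerBall_le_siegelLowerBall_zero (K := K) hμ0
  have hQ'n := iSup_leviColumnBall_le_normalizer_siegelLowerBall (K := K) (0 : Fin n → ℤ)
  have hQn := iSup_leviColumnBall_le_normalizer_siegelLowerBall (K := K) μ
  rw [sup_comm (siegelLowerBall n K μ), sup_comm (siegelLowerBall n K (0 : Fin n → ℤ)),
    relIndex_eq_mul_relIndex_of_devissage (sup_le_sup hQmono hNmono) le_sup_right le_sup_left
      (Subgroup.coe_mul_of_left_le_normalizer_right _ _ hQ'n).subset (sup_le hQ'n Subgroup.le_normalizer)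
      (Subgroup.coe_mul_of_left_le_normalizer_right _ _ hQn).subset le_sup_left
      (sup_inf_eq_right_of_disjoint hNmono hQn (iSup_leviColumnBall_inf_siegelLowerBall_eq_bot μ 0)) hQmono
      (iSup_leviColumnBall_inf_siegelLowerBall_eq_bot 0 0),
    hfull, hfull, relIndex_biSup_leviColumnBall_eq_pow hϖ hμ n le_rfl, relIndex_siegelLowerBall hϖ μ 0, ← pow_add]
  congr 1
  simp only [Fin.is_lt, if_true, Pi.zero_apply, add_zero, zero_sub, neg_add']

end Chain

/-! ## §4 Torus removal: `[B(𝒪) : B(𝒪) ∩ t_μB(𝒪)t_μ⁻¹] = [U(0) : U(μ)]` and the evaluation for antidominant `μ` -/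

section Torus

variable [Valued K ℤᵐ⁰] {ϖ : K}

/-- **`[B(𝒪) : B(𝒪) ∩ t_μB(𝒪)t_μ⁻¹] = [U(𝒪) : U(𝒪) ∩ t_μU(𝒪)t_μ⁻¹]`** for every `μ`: the torus `T(𝒪) ⊆ B(𝒪) ∩ t_μB(𝒪)t_μ⁻¹`
is removed (`B(𝒪) = U(𝒪)·T(𝒪)`, conjugation preserves diagonals). [cite: CartierCorvallis1979, §I.3, §IV (4.2)]
[cite: Laumon1995, (4.1.4)] -/
theorem relIndex_conjAct_borelInt_eq_relIndex_unipotentInt (hϖ : Valued.v ϖ = WithZero.exp (-1 : ℤ))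
    {t : symplecticGroup (Fin n) K} {μ : Fin n → ℤ}
    (ht : (t : Matrix (Fin n ⊕ Fin n) (Fin n ⊕ Fin n) K) = Matrix.diagonal fun s => ϖ ^ Sum.elim μ (-μ) s) :
    (toConjAct t • (symplecticBorel n K ⊓ symplecticInt (Fin n) K)).relIndex (symplecticBorel n K ⊓ symplecticInt (Fin n) K) =
      (toConjAct t • (symplecticUnipotent n K ⊓ symplecticInt (Fin n) K)).relIndex
        (symplecticUnipotent n K ⊓ symplecticInt (Fin n) K) := by
  have hUB : symplecticUnipotent n K ⊓ symplecticInt (Fin n) K ≤ symplecticBorel n K ⊓ symplecticInt (Fin n) K :=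
    inf_le_inf_right _ symplecticUnipotent_le_symplecticBorel
  rw [relIndex_eq_relIndex_of_coe_subset_mul hUB (borelInt_subset_unipotentInt_mul_conjAct ht),
    ← Subgroup.inf_relIndex_left, unipotentInt_inf_conjAct_borelInt_eq hϖ ht, Subgroup.inf_relIndex_left]

/-- **THE MODULUS INDEX EVALUATED (sum form)**: for `μ` monotone `≤ 0` (antidominant for the Borel of the tree),
`[B(𝒪) : B(𝒪) ∩ t_μB(𝒪)t_μ⁻¹] = q^{Σ_j Σ_{a<j} (μ_j - μ_a) + Σ_{a≤b} (-μ_a - μ_b)}` — the product over the positive roots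
`f_a - f_j (a<j)`, `-(f_a + f_b) (a ≤ b)` made negative by `t_μ` of `q^{|⟨α, μ⟩|}`. [cite: Macdonald1995, Ch. V (2.6), (2.9)]
[cite: CartierCorvallis1979, §I.3, §IV (4.2)] [cite: Laumon1995, (4.1.4)] -/
theorem relIndex_conjAct_borelInt_eq_pow_sum (hϖ : Valued.v ϖ = WithZero.exp (-1 : ℤ)) [Finite 𝓀[K]]
    {t : symplecticGroup (Fin n) K} {μ : Fin n → ℤ}
    (ht : (t : Matrix (Fin n ⊕ Fin n) (Fin n ⊕ Fin n) K) = Matrix.diagonal fun s => ϖ ^ Sum.elim μ (-μ) s)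
    (hμ : Monotone μ) (hμ0 : ∀ i, μ i ≤ 0) :
    (toConjAct t • (symplecticBorel n K ⊓ symplecticInt (Fin n) K)).relIndex (symplecticBorel n K ⊓ symplecticInt (Fin n) K) =
      Nat.card 𝓀[K] ^ ((∑ j : Fin n, ∑ a ∈ Finset.Iio j, (μ j - μ a).toNat) +
        ∑ p ∈ Finset.univ.filter (fun p : Fin n × Fin n => p.1 ≤ p.2), (-μ p.1 - μ p.2).toNat) := by
  rw [relIndex_conjAct_borelInt_eq_relIndex_unipotentInt hϖ ht, conjAct_smul_unipotentInt_eq hϖ ht, unipotentInt_eq_sup]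
  exact relIndex_unipotentBall_eq_pow hϖ hμ hμ0

/-- **`[t_μB(𝒪)t_μ⁻¹ : B(𝒪) ∩ t_μB(𝒪)t_μ⁻¹] = 1`** for `μ` monotone `≤ 0` (antidominant torus elements contract `B(𝒪)`).
[cite: BruhatTits1972, (4.4.4)] [cite: CartierCorvallis1979, §IV (4.2)] -/
theorem relIndex_borelInt_conjAct_eq_one (hϖ : Valued.v ϖ = WithZero.exp (-1 : ℤ)) {t : symplecticGroup (Fin n) K}
    {μ : Fin n → ℤ} (ht : (t : Matrix (Fin n ⊕ Fin n) (Fin n ⊕ Fin n) K) = Matrix.diagonal fun s => ϖ ^ Sum.elim μ (-μ) s)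
    (hμ : Monotone μ) (hμ0 : ∀ i, μ i ≤ 0) :
    (symplecticBorel n K ⊓ symplecticInt (Fin n) K).relIndex (toConjAct t • (symplecticBorel n K ⊓ symplecticInt (Fin n) K)) = 1 :=
  Subgroup.relIndex_eq_one.2 (conjAct_smul_inf_le_of_monotone_nonpos_symplectic hϖ ht hμ hμ0)

end Torus

/-! ## §5 The exponent is `-2⟨ρ, μ⟩` -/

section Exponent

/-- `⟨ρ, -a⟩ = -⟨ρ, a⟩`. [cite: CartierCorvallis1979, §IV (4.2)] -/
theorem symplecticRhoPairing_neg (a : Fin n → ℤ) : symplecticRhoPairing (-a) = -symplecticRhoPairing a := by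
  simp only [symplecticRhoPairing, Pi.neg_apply, mul_neg, Finset.sum_neg_distrib]

/-- `⟨ρ, a⟩ ≤ 0` for `a ≤ 0`. [cite: CartierCorvallis1979, §IV (4.2)] -/
theorem symplecticRhoPairing_nonpos {a : Fin n → ℤ} (ha : ∀ i, a i ≤ 0) : symplecticRhoPairing a ≤ 0 :=
  Finset.sum_nonpos fun i _ => mul_nonpos_of_nonneg_of_nonpos (by have := i.is_lt; omega) (ha i)

/-- **The sum over the positive roots**: `Σ_j Σ_{a<j} (μ_j - μ_a) + Σ_{a≤b} (-μ_a - μ_b) = -2⟨ρ, μ⟩` for every `μ ∈ ℤⁿ` — the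
pairings of `μ` with the roots `f_j - f_a (a < j)`, `-f_a - f_b (a ≤ b)` of `U` (the roots of the LOWER Borel of the tree in the
`f`-basis) add up to `-2ρ = -Σ_i 2(n - i) f_i^∨`-pairing: the coefficient of `μ_i` is `i - (n-1-i) - (n-i) - (i+1) + … = -2(n-i)`.
[cite: CartierCorvallis1979, §IV (4.2)] [cite: Macdonald1995, Ch. V (2.6), (2.9)] -/
theorem sum_sub_add_sum_neg_eq_neg_two_mul_symplecticRhoPairing (μ : Fin n → ℤ) :
    (∑ j : Fin n, ∑ a ∈ Finset.Iio j, (μ j - μ a)) +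
        ∑ p ∈ Finset.univ.filter (fun p : Fin n × Fin n => p.1 ≤ p.2), (-μ p.1 - μ p.2) =
      -(2 * symplecticRhoPairing μ) := by
  have hL : (∑ j : Fin n, ∑ a ∈ Finset.Iio j, (μ j - μ a)) =
      ∑ a : Fin n, ∑ b : Fin n, if a < b then μ b - μ a else 0 := by
    rw [Finset.sum_comm]
    refine Finset.sum_congr rfl fun b _ => ?_
    rw [← Finset.sum_filter]
    exact Finset.sum_congr (by ext a; simp) fun _ _ => rfl
  have hS : ∑ p ∈ Finset.univ.filter (fun p : Fin n × Fin n => p.1 ≤ p.2), (-μ p.1 - μ p.2) =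
      ∑ a : Fin n, ∑ b : Fin n, if a ≤ b then -μ a - μ b else 0 := by
    rw [Finset.sum_filter, ← Finset.univ_product_univ, Finset.sum_product]
  rw [hL, hS, ← Finset.sum_add_distrib, symplecticRhoPairing, Finset.mul_sum, ← Finset.sum_neg_distrib]
  refine Finset.sum_congr rfl fun a _ => ?_
  have hpt : ∀ b : Fin n, ((if a < b then μ b - μ a else 0) + if a ≤ b then -μ a - μ b else 0) =
      if a ≤ b then -2 * μ a else 0 := by
    intro b
    by_cases hab : a ≤ b
    · rcases hab.lt_or_eq with h | h
      · rw [if_pos h, if_pos hab, if_pos hab]; ring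
      · subst h
        rw [if_neg (lt_irrefl _), if_pos hab, if_pos hab]; ring
    · rw [if_neg (fun h => hab h.le), if_neg hab, if_neg hab, add_zero]
  rw [← Finset.sum_add_distrib, Finset.sum_congr rfl fun b _ => hpt b, ← Finset.sum_filter, Finset.sum_const,
    show Finset.univ.filter (fun b : Fin n => a ≤ b) = Finset.Ici a by ext b; simp, Fin.card_Ici, nsmul_eq_mul]
  have hna : ((n - (a : ℕ) : ℕ) : ℤ) = (n : ℤ) - (a : ℕ) := by
    have := a.is_lt
    omega
  rw [hna]
  ring

/-- For `μ` monotone `≤ 0` every root term is `≥ 0`, so the `ℕ`-valued exponent of §4 is `(-2⟨ρ, μ⟩)⁺ = -2⟨ρ, μ⟩`.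
[cite: CartierCorvallis1979, §IV (4.2)] [cite: Macdonald1995, Ch. V (2.6)] -/
theorem sum_toNat_add_sum_toNat_eq (μ : Fin n → ℤ) (hμ : Monotone μ) (hμ0 : ∀ i, μ i ≤ 0) :
    (∑ j : Fin n, ∑ a ∈ Finset.Iio j, (μ j - μ a).toNat) +
        ∑ p ∈ Finset.univ.filter (fun p : Fin n × Fin n => p.1 ≤ p.2), (-μ p.1 - μ p.2).toNat =
      (-(2 * symplecticRhoPairing μ)).toNat := by
  have hE : (((∑ j : Fin n, ∑ a ∈ Finset.Iio j, (μ j - μ a).toNat) +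
      ∑ p ∈ Finset.univ.filter (fun p : Fin n × Fin n => p.1 ≤ p.2), (-μ p.1 - μ p.2).toNat : ℕ) : ℤ) =
        -(2 * symplecticRhoPairing μ) := by
    rw [← sum_sub_add_sum_neg_eq_neg_two_mul_symplecticRhoPairing μ]
    push_cast
    congr 1
    · refine Finset.sum_congr rfl fun j _ => Finset.sum_congr rfl fun a ha => ?_
      exact Int.toNat_of_nonneg (sub_nonneg.2 (hμ (Finset.mem_Iio.1 ha).le))
    · refine Finset.sum_congr rfl fun p _ => ?_
      exact Int.toNat_of_nonneg (by linarith [hμ0 p.1, hμ0 p.2])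
  omega

end Exponent

/-! ## §6 The headline evaluations -/

section Evaluation

variable [Valued K ℤᵐ⁰] {ϖ : K}

/-- **THE MODULUS INDEX OF `B(𝒪) ≤ Sp_{2n}(K)` EVALUATED: `[B(𝒪) : B(𝒪) ∩ t_μB(𝒪)t_μ⁻¹] = q^{-2⟨ρ, μ⟩}` for `μ ∈ ℤⁿ`
monotone and `≤ 0`** (`t_μ = diag(ϖ^μ; ϖ^{-μ})`, `q = #𝓀`, `⟨ρ, μ⟩ = Σ_i (n - i) μ_i`) — i.e. `δ_B(t_μ)^{∓1} = q^{2⟨ρ,μ⟩}`: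
the index left abstract by `SatakeTransformDuality` (g44-#1, #4) is the modulus character. [cite: CartierCorvallis1979, §I.3,
§IV (4.2)] [cite: Macdonald1995, Ch. V (2.6), (2.9)] [cite: Laumon1995, (4.1.4)] [cite: BruhatTits1972, (4.4.4)] -/
theorem relIndex_conjAct_borelInt_eq_pow (hϖ : Valued.v ϖ = WithZero.exp (-1 : ℤ)) [Finite 𝓀[K]]
    {t : symplecticGroup (Fin n) K} {μ : Fin n → ℤ}
    (ht : (t : Matrix (Fin n ⊕ Fin n) (Fin n ⊕ Fin n) K) = Matrix.diagonal fun s => ϖ ^ Sum.elim μ (-μ) s)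
    (hμ : Monotone μ) (hμ0 : ∀ i, μ i ≤ 0) :
    (toConjAct t • (symplecticBorel n K ⊓ symplecticInt (Fin n) K)).relIndex (symplecticBorel n K ⊓ symplecticInt (Fin n) K) =
      Nat.card 𝓀[K] ^ (-(2 * symplecticRhoPairing μ)).toNat := by
  rw [relIndex_conjAct_borelInt_eq_pow_sum hϖ ht hμ hμ0, sum_toNat_add_sum_toNat_eq μ hμ hμ0]

/-- **Dominant form**: for `μ` antitone and `≥ 0`, `[t_μB(𝒪)t_μ⁻¹ : B(𝒪) ∩ t_μB(𝒪)t_μ⁻¹] = q^{2⟨ρ, μ⟩}` (conjugate by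
`t_μ⁻¹ = t_{-μ}`). [cite: CartierCorvallis1979, §IV (4.2)] [cite: Macdonald1995, Ch. V (2.6), (2.9)] [cite: BruhatTits1972, (4.4.4)] -/
theorem relIndex_borelInt_conjAct_eq_pow (hϖ : Valued.v ϖ = WithZero.exp (-1 : ℤ)) [Finite 𝓀[K]]
    {t : symplecticGroup (Fin n) K} {μ : Fin n → ℤ}
    (ht : (t : Matrix (Fin n ⊕ Fin n) (Fin n ⊕ Fin n) K) = Matrix.diagonal fun s => ϖ ^ Sum.elim μ (-μ) s)
    (hμ : Antitone μ) (hμ0 : ∀ i, 0 ≤ μ i) :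
    (symplecticBorel n K ⊓ symplecticInt (Fin n) K).relIndex (toConjAct t • (symplecticBorel n K ⊓ symplecticInt (Fin n) K)) =
      Nat.card 𝓀[K] ^ (2 * symplecticRhoPairing μ).toNat := by
  have h := relIndex_conjAct_borelInt_eq_pow hϖ (coe_inv_eq_diagonal_zpow_neg hϖ ht) hμ.neg fun i => by
    simp only [Pi.neg_apply, Left.neg_nonpos_iff]
    exact hμ0 i
  rw [toConjAct_inv, symplecticRhoPairing_neg, mul_neg, neg_neg] at h
  have e := Subgroup.relIndex_pointwise_smul (toConjAct t)⁻¹ (symplecticBorel n K ⊓ symplecticInt (Fin n) K)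
    (toConjAct t • (symplecticBorel n K ⊓ symplecticInt (Fin n) K))
  rw [inv_smul_smul] at e
  rw [← e, h]

/-- Dominant torus elements expand: `[B(𝒪) : B(𝒪) ∩ t_μB(𝒪)t_μ⁻¹] = 1` for `μ` antitone `≥ 0`. [cite: BruhatTits1972, (4.4.4)] -/
theorem relIndex_conjAct_borelInt_eq_one (hϖ : Valued.v ϖ = WithZero.exp (-1 : ℤ)) {t : symplecticGroup (Fin n) K}
    {μ : Fin n → ℤ} (ht : (t : Matrix (Fin n ⊕ Fin n) (Fin n ⊕ Fin n) K) = Matrix.diagonal fun s => ϖ ^ Sum.elim μ (-μ) s)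
    (hμ : Antitone μ) (hμ0 : ∀ i, 0 ≤ μ i) :
    (toConjAct t • (symplecticBorel n K ⊓ symplecticInt (Fin n) K)).relIndex (symplecticBorel n K ⊓ symplecticInt (Fin n) K) = 1 :=
  Subgroup.relIndex_eq_one.2 (inf_le_conjAct_smul_of_antitone_nonneg_symplectic hϖ ht hμ hμ0)

/-- **The dominant-extreme count evaluated**: for `a ∈ ℕⁿ` antitone,
`#{γ ∈ K₀ d(a) K₀ / K₀ : a(γ) = -a} = q^{2⟨ρ, a⟩}` (`d(a) = diag(ϖ^a; ϖ^{-a})`; the tree's `…_eq_relIndex` with the index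
evaluated) — Macdonald's leading coefficient `q^{⟨λ, 2ρ⟩}` of the spherical function, for `Sp_{2n}`; e.g. `SL₂`:
`#{γ ∈ K₀ diag(ϖ; ϖ⁻¹) K₀/K₀ : a(γ) = -1} = q²`. [cite: Macdonald1995, Ch. V (2.6)–(2.9)] [cite: BruhatTits1972, Prop. (4.4.4)]
[cite: CartierCorvallis1979, §IV (4.2)] -/
theorem card_filter_symplecticIwasawaExp_orbit_neg_eq_pow (hϖ : Valued.v ϖ = WithZero.exp (-1 : ℤ)) [Finite 𝓀[K]]
    [IsHeckeTriple (⊤ : Submonoid (symplecticGroup (Fin n) K)) (symplecticInt (Fin n) K) (symplecticInt (Fin n) K)]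
    {a : Fin n → ℕ} (ha : Antitone a)
    [DecidablePred fun γ : symplecticGroup (Fin n) K ⧸ symplecticInt (Fin n) K =>
      symplecticIwasawaExp hϖ γ.out = -fun i => (a i : ℤ)] :
    ((finite_orbit_quotient (symplecticInt (Fin n) K)
        ((⟨Matrix.diagonal (Sum.elim (fun i => ϖ ^ a i) (fun i => (ϖ ^ a i)⁻¹)),
          diagonal_pow_mem_symplecticGroup (uniformizer_ne_zero hϖ) a⟩ : symplecticGroup (Fin n) K))).toFinset.filter
        (fun γ => symplecticIwasawaExp hϖ γ.out = -fun i => (a i : ℤ))).card =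
      Nat.card 𝓀[K] ^ (2 * symplecticRhoPairing fun i => (a i : ℤ)).toNat := by
  rw [card_filter_symplecticIwasawaExp_orbit_neg_eq_relIndex hϖ ha,
    relIndex_borelInt_conjAct_eq_pow hϖ (coe_diagonal_pow_eq_diagonal_zpow (uniformizer_ne_zero hϖ) a)
      (fun i j hij => Int.ofNat_le.2 (ha hij)) fun i => Int.natCast_nonneg _]

end Evaluation

/-! ## §7 The index ratio for every `μ` and the counting duality with `q` explicit -/

section Ratio

variable [Valued K ℤᵐ⁰] {ϖ : K}

omit [Valued K ℤᵐ⁰] in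
/-- `t_μ t_{μ'} = t_{μ+μ'}` on matrices. [cite: AndrianovZhuravlev1995, Ch. 3 §3 Lemma 3.6] -/
theorem coe_mul_eq_diagonal_zpow_add (hϖ0 : ϖ ≠ 0) {t t' : symplecticGroup (Fin n) K} {μ μ' : Fin n → ℤ}
    (ht : (t : Matrix (Fin n ⊕ Fin n) (Fin n ⊕ Fin n) K) = Matrix.diagonal fun s => ϖ ^ Sum.elim μ (-μ) s)
    (ht' : (t' : Matrix (Fin n ⊕ Fin n) (Fin n ⊕ Fin n) K) = Matrix.diagonal fun s => ϖ ^ Sum.elim μ' (-μ') s) :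
    ((t * t' : symplecticGroup (Fin n) K) : Matrix (Fin n ⊕ Fin n) (Fin n ⊕ Fin n) K) =
      Matrix.diagonal fun s => ϖ ^ Sum.elim (μ + μ') (-(μ + μ')) s := by
  rw [Submonoid.coe_mul, ht, ht', Matrix.diagonal_mul_diagonal]
  congr 1
  funext s
  rw [← zpow_add₀ hϖ0]
  rcases s with i | i <;> simp only [Sum.elim_inl, Sum.elim_inr, Pi.add_apply, Pi.neg_apply, neg_add]

variable [IsHeckeTriple (⊤ : Submonoid (symplecticGroup (Fin n) K)) (symplecticInt (Fin n) K) (symplecticInt (Fin n) K)]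

/-- **THE INDEX RATIO FOR EVERY `μ ∈ ℤⁿ`**:
`[t_μB(𝒪)t_μ⁻¹ : B(𝒪) ∩ t_μB(𝒪)t_μ⁻¹] · q^{(-2⟨ρ,μ⟩)⁺} = [B(𝒪) : B(𝒪) ∩ t_μB(𝒪)t_μ⁻¹] · q^{(2⟨ρ,μ⟩)⁺}`, i.e. the ratio of
the two indices is `δ_B(t_μ) = q^{2⟨ρ,μ⟩}` — from the antidominant evaluation applied to `λ` and `μ + λ` (`λ_i = 2C i - 2Cn - C`,
`C = Σ|μ_i|`) and the multiplicativity of the ratio (`SatakeTransformDuality.relIndex_conj_mul_conj`).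
[cite: CartierCorvallis1979, §I.3, §IV (4.2)] [cite: Laumon1995, (4.1.4)] [cite: Macdonald1995, Ch. V (2.6)] -/
theorem relIndex_borelInt_conjAct_mul_pow_eq (hϖ : Valued.v ϖ = WithZero.exp (-1 : ℤ)) [Finite 𝓀[K]]
    {t : symplecticGroup (Fin n) K} {μ : Fin n → ℤ}
    (ht : (t : Matrix (Fin n ⊕ Fin n) (Fin n ⊕ Fin n) K) = Matrix.diagonal fun s => ϖ ^ Sum.elim μ (-μ) s) :
    (symplecticBorel n K ⊓ symplecticInt (Fin n) K).relIndex (toConjAct t • (symplecticBorel n K ⊓ symplecticInt (Fin n) K)) *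
        Nat.card 𝓀[K] ^ (-(2 * symplecticRhoPairing μ)).toNat =
      (toConjAct t • (symplecticBorel n K ⊓ symplecticInt (Fin n) K)).relIndex (symplecticBorel n K ⊓ symplecticInt (Fin n) K) *
        Nat.card 𝓀[K] ^ (2 * symplecticRhoPairing μ).toNat := by
  have hϖ0 := uniformizer_ne_zero hϖ
  -- an antidominant `λ` with `μ + λ` antidominant
  set C : ℤ := ∑ i : Fin n, |μ i| with hC
  have hCi : ∀ i, |μ i| ≤ C := fun i => Finset.single_le_sum (fun i _ => abs_nonneg (μ i)) (Finset.mem_univ i)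
  have hC0 : 0 ≤ C := Finset.sum_nonneg fun i _ => abs_nonneg (μ i)
  set lam : Fin n → ℤ := fun i => 2 * C * (i : ℕ) - (2 * C * n + C) with hlam
  have hlam_mono : Monotone lam := fun i j hij => by
    have hij' : ((i : ℕ) : ℤ) ≤ ((j : ℕ) : ℤ) := by exact_mod_cast (show (i : ℕ) ≤ (j : ℕ) from hij)
    simp only [hlam]
    nlinarith
  have hlam0 : ∀ i, lam i ≤ 0 := fun i => by
    have hi : ((i : ℕ) : ℤ) < n := by exact_mod_cast i.is_lt
    simp only [hlam]
    nlinarith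
  have hsum_mono : Monotone (μ + lam) := fun i j hij => by
    rcases eq_or_lt_of_le hij with h | h
    · rw [h]
    · have hij' : ((i : ℕ) : ℤ) + 1 ≤ ((j : ℕ) : ℤ) := by exact_mod_cast (show (i : ℕ) < (j : ℕ) from h)
      simp only [Pi.add_apply, hlam]
      have h1 := hCi i; have h2 := hCi j
      have h3 := le_abs_self (μ i); have h4 := neg_abs_le (μ j)
      nlinarith
  have hsum0 : ∀ i, (μ + lam) i ≤ 0 := fun i => by
    have hi : ((i : ℕ) : ℤ) + 1 ≤ n := by exact_mod_cast (show (i : ℕ) < n from i.is_lt)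
    simp only [Pi.add_apply, hlam]
    have h1 := hCi i; have h3 := le_abs_self (μ i)
    nlinarith
  obtain ⟨t', ht'⟩ := exists_coe_eq_diagonal_zpow_symplectic (K := K) hϖ0 lam
  have htt' := coe_mul_eq_diagonal_zpow_add hϖ0 ht ht'
  have key := IsIwasawaExponent.relIndex_conj_mul_conj (K := symplecticInt (Fin n) K)
    (mem_symplecticBorel_of_coe_eq_diagonal ht) (mem_symplecticBorel_of_coe_eq_diagonal ht')
  rw [relIndex_conjAct_borelInt_eq_pow hϖ htt' hsum_mono hsum0, relIndex_borelInt_conjAct_eq_one hϖ ht' hlam_mono hlam0,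
    relIndex_borelInt_conjAct_eq_one hϖ htt' hsum_mono hsum0, relIndex_conjAct_borelInt_eq_pow hϖ ht' hlam_mono hlam0,
    mul_one, one_mul, symplecticRhoPairing_add] at key
  -- `key : q^{(-2(r+ℓ))⁺} · D₁ = D₂ · q^{(-2ℓ)⁺}` with `r = ⟨ρ,μ⟩`, `ℓ = ⟨ρ,λ⟩ ≤ 0`, `r + ℓ ≤ 0`
  have hq : 0 < Nat.card 𝓀[K] := Nat.card_pos
  have hℓ := symplecticRhoPairing_nonpos hlam0
  have hrℓ := symplecticRhoPairing_nonpos hsum0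
  rw [symplecticRhoPairing_add] at hrℓ
  set r := symplecticRhoPairing μ with hr
  set ℓ := symplecticRhoPairing lam with hℓdef
  set D₁ := (symplecticBorel n K ⊓ symplecticInt (Fin n) K).relIndex
    (toConjAct t • (symplecticBorel n K ⊓ symplecticInt (Fin n) K)) with hD₁
  set D₂ := (toConjAct t • (symplecticBorel n K ⊓ symplecticInt (Fin n) K)).relIndex
    (symplecticBorel n K ⊓ symplecticInt (Fin n) K) with hD₂
  rcases le_or_gt r 0 with hr0 | hr0
  · rw [Int.toNat_of_nonpos (by omega : 2 * r ≤ 0), pow_zero, mul_one]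
    have e : (-(2 * (r + ℓ))).toNat = (-(2 * r)).toNat + (-(2 * ℓ)).toNat := by omega
    rw [e, pow_add] at key
    have hqB : Nat.card 𝓀[K] ^ (-(2 * ℓ)).toNat ≠ 0 := pow_ne_zero _ hq.ne'
    refine mul_right_cancel₀ hqB ?_
    calc D₁ * Nat.card 𝓀[K] ^ (-(2 * r)).toNat * Nat.card 𝓀[K] ^ (-(2 * ℓ)).toNat
        = Nat.card 𝓀[K] ^ (-(2 * r)).toNat * Nat.card 𝓀[K] ^ (-(2 * ℓ)).toNat * D₁ := by ring
      _ = D₂ * Nat.card 𝓀[K] ^ (-(2 * ℓ)).toNat := key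
  · rw [Int.toNat_of_nonpos (by omega : -(2 * r) ≤ 0), pow_zero, mul_one]
    have e : (-(2 * ℓ)).toNat = (-(2 * (r + ℓ))).toNat + (2 * r).toNat := by omega
    rw [e, pow_add, ← mul_assoc] at key
    have hqA : Nat.card 𝓀[K] ^ (-(2 * (r + ℓ))).toNat ≠ 0 := pow_ne_zero _ hq.ne'
    refine mul_right_cancel₀ hqA ?_
    calc D₁ * Nat.card 𝓀[K] ^ (-(2 * (r + ℓ))).toNat = Nat.card 𝓀[K] ^ (-(2 * (r + ℓ))).toNat * D₁ := mul_comm _ _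
      _ = D₂ * Nat.card 𝓀[K] ^ (-(2 * (r + ℓ))).toNat * Nat.card 𝓀[K] ^ (2 * r).toNat := key
      _ = D₂ * Nat.card 𝓀[K] ^ (2 * r).toNat * Nat.card 𝓀[K] ^ (-(2 * (r + ℓ))).toNat := by ring

/-- **DUALITY WITH `q` EXPLICIT** (counting version): for every `g ∈ Sp_{2n}(K)` and `μ ∈ ℤⁿ`,
`#{γ ∈ K₀gK₀/K₀ : a γ = μ} · q^{(2⟨ρ,μ⟩)⁺} = #{γ ∈ K₀gK₀/K₀ : a γ = -μ} · q^{(-2⟨ρ,μ⟩)⁺}` — the symmetry `w₀ = -1` of the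
left-coset counts of a double coset, weighted by the modulus. [cite: CartierCorvallis1979, §IV (4.2), Thm. 4.1]
[cite: Macdonald1995, Ch. V (2.6), (3.4)] [cite: Laumon1995, (4.1.4)–(4.1.6)] -/
theorem card_filter_symplecticIwasawaExp_mul_pow_eq (hϖ : Valued.v ϖ = WithZero.exp (-1 : ℤ)) [Finite 𝓀[K]]
    (g : symplecticGroup (Fin n) K) (μ : Fin n → ℤ)
    [DecidablePred fun α : symplecticGroup (Fin n) K ⧸ symplecticInt (Fin n) K => symplecticIwasawaExp hϖ α.out = μ]
    [DecidablePred fun α : symplecticGroup (Fin n) K ⧸ symplecticInt (Fin n) K => symplecticIwasawaExp hϖ α.out = -μ] :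
    ((finite_orbit_quotient (symplecticInt (Fin n) K) g).toFinset.filter
          (fun α => symplecticIwasawaExp hϖ α.out = μ)).card * Nat.card 𝓀[K] ^ (2 * symplecticRhoPairing μ).toNat =
      ((finite_orbit_quotient (symplecticInt (Fin n) K) g).toFinset.filter
          (fun α => symplecticIwasawaExp hϖ α.out = -μ)).card * Nat.card 𝓀[K] ^ (-(2 * symplecticRhoPairing μ)).toNat := by
  obtain ⟨t, ht⟩ := exists_coe_eq_diagonal_zpow_symplectic (K := K) (uniformizer_ne_zero hϖ) μ
  have hD := card_filter_symplecticIwasawaExp_mul_relIndex_eq hϖ g ht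
  have hR := relIndex_borelInt_conjAct_mul_pow_eq hϖ ht
  have htP := mem_symplecticBorel_of_coe_eq_diagonal ht
  have hi₂ : (toConjAct t • (symplecticBorel n K ⊓ symplecticInt (Fin n) K)).relIndex
      (symplecticBorel n K ⊓ symplecticInt (Fin n) K) ≠ 0 :=
    IsIwasawaExponent.relIndex_conj_ne_zero (K := symplecticInt (Fin n) K) htP
  have hi₁ : (symplecticBorel n K ⊓ symplecticInt (Fin n) K).relIndex
      (toConjAct t • (symplecticBorel n K ⊓ symplecticInt (Fin n) K)) ≠ 0 :=
    IsIwasawaExponent.relIndex_conj_ne_zero' (K := symplecticInt (Fin n) K) htP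
  set N₁ := ((finite_orbit_quotient (symplecticInt (Fin n) K) g).toFinset.filter
    (fun α => symplecticIwasawaExp hϖ α.out = μ)).card
  set N₂ := ((finite_orbit_quotient (symplecticInt (Fin n) K) g).toFinset.filter
    (fun α => symplecticIwasawaExp hϖ α.out = -μ)).card
  set i₁ := (symplecticBorel n K ⊓ symplecticInt (Fin n) K).relIndex
    (toConjAct t • (symplecticBorel n K ⊓ symplecticInt (Fin n) K))
  set i₂ := (toConjAct t • (symplecticBorel n K ⊓ symplecticInt (Fin n) K)).relIndex
    (symplecticBorel n K ⊓ symplecticInt (Fin n) K)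
  set qp := Nat.card 𝓀[K] ^ (2 * symplecticRhoPairing μ).toNat
  set qm := Nat.card 𝓀[K] ^ (-(2 * symplecticRhoPairing μ)).toNat
  -- `N₁ i₁ = N₂ i₂` and `i₁ qm = i₂ qp` ⇒ `N₁ qp (i₁ i₂) = N₂ qm (i₁ i₂)`
  have h : N₁ * qp * (i₁ * i₂) = N₂ * qm * (i₁ * i₂) := by
    calc N₁ * qp * (i₁ * i₂) = (N₁ * i₁) * (i₂ * qp) := by ring
      _ = (N₂ * i₂) * (i₁ * qm) := by rw [hD, ← hR]
      _ = N₂ * qm * (i₁ * i₂) := by ring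
  exact mul_right_cancel₀ (mul_ne_zero hi₁ hi₂) h

end Ratio

/-! ## §8 The `w₀`-invariance of the Satake transform `𝒮_q` for every `n` -/

section Satake

variable [Valued K ℤᵐ⁰] {ϖ : K} {R : Type*} [CommRing R] (hϖ : Valued.v ϖ = WithZero.exp (-1 : ℤ)) [Finite 𝓀[K]]
  [IsHeckeTriple (⊤ : Submonoid (symplecticGroup (Fin n) K)) (symplecticInt (Fin n) K) (symplecticInt (Fin n) K)]
include hϖ

/-- **`𝒮_q(T_g)_{-μ} = 𝒮_q(T_g)_μ`** for `q ∈ Rˣ` the residue cardinality: the coefficient formula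
`𝒮_q(T_g)_μ = #{γ : a γ = μ} q^{⟨ρ,μ⟩}` and the counting duality (`#{a γ = μ} q^{(2⟨ρ,μ⟩)⁺} = #{a γ = -μ} q^{(-2⟨ρ,μ⟩)⁺}`).
[cite: CartierCorvallis1979, §IV (4.2), Thm. 4.1] [cite: AndrianovZhuravlev1995, Ch. 3 §3.3 (3.44)–(3.49)] -/
theorem coeff_symplecticSatakeTransform_doubleCosetOperator_neg (q : Rˣ) (hq : (q : R) = Nat.card 𝓀[K])
    (g : symplecticGroup (Fin n) K) (μ : Fin n → ℤ) :
    (symplecticSatakeTransform hϖ q (heckeAlgebra.doubleCosetOperator (symplecticInt (Fin n) K) g)).coeff (-μ) =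
      (symplecticSatakeTransform hϖ q (heckeAlgebra.doubleCosetOperator (symplecticInt (Fin n) K) g)).coeff μ := by
  classical
  have hC := card_filter_symplecticIwasawaExp_mul_pow_eq hϖ g μ
  set r := symplecticRhoPairing μ with hr
  have hC' : (((finite_orbit_quotient (symplecticInt (Fin n) K) g).toFinset.filter
        (fun α => symplecticIwasawaExp hϖ α.out = μ)).card : R) * ((q ^ ((2 * r).toNat : ℤ) : Rˣ) : R) =
      (((finite_orbit_quotient (symplecticInt (Fin n) K) g).toFinset.filter
        (fun α => symplecticIwasawaExp hϖ α.out = -μ)).card : R) * ((q ^ ((-(2 * r)).toNat : ℤ) : Rˣ) : R) := by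
    have h := congrArg (Nat.cast : ℕ → R) hC
    push_cast at h
    rwa [← hq, ← Units.val_pow_eq_pow_val, ← Units.val_pow_eq_pow_val, ← zpow_natCast, ← zpow_natCast] at h
  rw [coeff_symplecticSatakeTransform_doubleCosetOperator, coeff_symplecticSatakeTransform_doubleCosetOperator,
    symplecticRhoPairing_neg, ← hr]
  have e1 : q ^ r = q ^ ((2 * r).toNat : ℤ) * q ^ (r - ((2 * r).toNat : ℤ)) := by
    rw [← _root_.zpow_add]; congr 1; ring
  have e2 : q ^ (-r) = q ^ ((-(2 * r)).toNat : ℤ) * q ^ (r - ((2 * r).toNat : ℤ)) := by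
    rw [← _root_.zpow_add]; congr 1; omega
  rw [e1, e2, Units.val_mul, Units.val_mul, ← mul_assoc, ← mul_assoc, hC']

/-- **THE `w₀`-INVARIANCE OF THE SATAKE TRANSFORM OF `Sp_{2n}`: `𝒮_q(T)_{-μ} = 𝒮_q(T)_μ` for EVERY `n`, every
`T ∈ ℋ(Sp_{2n}(K), Sp_{2n}(𝒪); R)` and every `μ ∈ ℤⁿ`**, when the parameter `q ∈ Rˣ` is the residue cardinality `#𝓀`
(Cartier's normalisation `δ^{1/2}`): the longest Weyl element `w₀ = -1 ∈ W(C_n)` fixes the Satake image.  By linearity from the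
double-coset operators. [cite: CartierCorvallis1979, §IV (4.2), Thm. 4.1] [cite: Satake1963, §§6–7] [cite: Macdonald1995, Ch. V (3.4)]
[cite: AndrianovZhuravlev1995, Ch. 3 §3.3 Thm. 3.30] -/
theorem coeff_symplecticSatakeTransform_neg (q : Rˣ) (hq : (q : R) = Nat.card 𝓀[K])
    (T : heckeAlgebra R (symplecticGroup (Fin n) K) (symplecticInt (Fin n) K)) (μ : Fin n → ℤ) :
    (symplecticSatakeTransform hϖ q T).coeff (-μ) = (symplecticSatakeTransform hϖ q T).coeff μ := by
  have hT := heckeAlgebra.mem_span_range_doubleCosetOperator (symplecticInt (Fin n) K) T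
  induction hT using Submodule.span_induction with
  | mem S hS =>
    obtain ⟨g, rfl⟩ := hS
    exact coeff_symplecticSatakeTransform_doubleCosetOperator_neg hϖ q hq g μ
  | zero => simp
  | add S S' _ _ hS hS' =>
    rw [map_add, AddMonoidAlgebra.coeff_add, Finsupp.add_apply, Finsupp.add_apply, hS, hS']
  | smul c S _ hS =>
    rw [map_smul, AddMonoidAlgebra.coeff_smul, Finsupp.smul_apply, Finsupp.smul_apply, hS]

/-- **`ι(𝒮_q T) = 𝒮_q T`** for `ι(x^μ) = x^{-μ}` (`= AddMonoidAlgebra.domCongr (neg)`): the whole Satake image of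
`ℋ(Sp_{2n}(K), Sp_{2n}(𝒪); R)` lies in the `w₀`-invariants `R[ℤⁿ]^{⟨-1⟩}`, for every `n` and every commutative ring `R` in
which `q = #𝓀` is a unit. [cite: CartierCorvallis1979, §IV Thm. 4.1] [cite: Satake1963, §§6–7] -/
theorem domCongr_neg_symplecticSatakeTransform (q : Rˣ) (hq : (q : R) = Nat.card 𝓀[K])
    (T : heckeAlgebra R (symplecticGroup (Fin n) K) (symplecticInt (Fin n) K)) :
    AddMonoidAlgebra.domCongr R R (AddEquiv.neg (Fin n → ℤ)) (symplecticSatakeTransform hϖ q T) =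
      symplecticSatakeTransform hϖ q T := by
  refine AddMonoidAlgebra.ext (Finsupp.ext fun μ => ?_)
  rw [IsIwasawaExponent.coeff_domCongr_neg, coeff_symplecticSatakeTransform_neg hϖ q hq]

/-- The Satake image is contained in the `w₀`-invariant Laurent polynomials. [cite: CartierCorvallis1979, §IV Thm. 4.1] -/
theorem range_symplecticSatakeTransform_subset (q : Rˣ) (hq : (q : R) = Nat.card 𝓀[K]) :
    Set.range (symplecticSatakeTransform (n := n) (R := R) hϖ q) ⊆ {f | ∀ μ : Fin n → ℤ, f.coeff (-μ) = f.coeff μ} := by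
  rintro _ ⟨T, rfl⟩ μ
  exact coeff_symplecticSatakeTransform_neg hϖ q hq T μ

end Satake

/-! ## §9 The counting transform `𝒮_1` of `Sp_{2n}` with `q` explicit -/

section Counting

variable [Valued K ℤᵐ⁰] {ϖ : K} {R : Type*} [CommRing R] (hϖ : Valued.v ϖ = WithZero.exp (-1 : ℤ)) [Finite 𝓀[K]]
  [IsHeckeTriple (⊤ : Submonoid (symplecticGroup (Fin n) K)) (symplecticInt (Fin n) K) (symplecticInt (Fin n) K)]
include hϖ

/-- **Antidominant coefficients of the counting transform**: for `μ` monotone `≤ 0` and every `T ∈ ℋ(Sp_{2n}(K), Sp_{2n}(𝒪); R)`,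
`𝒮_1(T)_μ = 𝒮_1(T)_{-μ} · q^{-2⟨ρ, μ⟩}` (the tree's `coeff_satakeTransform_one_eq_relIndex_mul_symplectic` with the index
evaluated; `SL₂`, `T = T_{diag(ϖ;ϖ⁻¹)}`: `𝒮_1(T)_{-1} = q²·𝒮_1(T)_1`). [cite: CartierCorvallis1979, §IV Thm. 4.1] [cite: Laumon1995, (4.1.4)]
[cite: Macdonald1995, Ch. V (2.6), (3.4)] -/
theorem coeff_satakeTransform_one_eq_mul_pow_symplectic
    (T : heckeAlgebra R (symplecticGroup (Fin n) K) (symplecticInt (Fin n) K)) {μ : Fin n → ℤ} (hμ : Monotone μ)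
    (hμ0 : ∀ i, μ i ≤ 0) :
    ((isIwasawaExponent_symplectic hϖ).satakeTransform (1 : Multiplicative (Fin n → ℤ) →* R) T).coeff μ =
      ((isIwasawaExponent_symplectic hϖ).satakeTransform (1 : Multiplicative (Fin n → ℤ) →* R) T).coeff (-μ) *
        ((Nat.card 𝓀[K] ^ (-(2 * symplecticRhoPairing μ)).toNat : ℕ) : R) := by
  obtain ⟨t, ht⟩ := exists_coe_eq_diagonal_zpow_symplectic (K := K) (uniformizer_ne_zero hϖ) μ
  rw [coeff_satakeTransform_one_eq_relIndex_mul_symplectic hϖ T ht hμ hμ0, relIndex_conjAct_borelInt_eq_pow hϖ ht hμ hμ0]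

/-- **THE `w₀`-SYMMETRY OF THE COUNTING TRANSFORM WITH `q` EXPLICIT**: for every `T ∈ ℋ(Sp_{2n}(K), Sp_{2n}(𝒪); R)` and every
`μ ∈ ℤⁿ`, `𝒮_1(T)_μ · q^{(2⟨ρ,μ⟩)⁺} = 𝒮_1(T)_{-μ} · q^{(-2⟨ρ,μ⟩)⁺}`, over every commutative ring `R` (by linearity from the
counting duality for the double-coset operators). [cite: CartierCorvallis1979, §IV (4.2), Thm. 4.1] [cite: Macdonald1995, Ch. V (3.4)]
[cite: AndrianovZhuravlev1995, Ch. 3 §3.3 Thm. 3.30] -/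
theorem coeff_satakeTransform_one_mul_pow_eq_symplectic
    (T : heckeAlgebra R (symplecticGroup (Fin n) K) (symplecticInt (Fin n) K)) (μ : Fin n → ℤ) :
    ((isIwasawaExponent_symplectic hϖ).satakeTransform (1 : Multiplicative (Fin n → ℤ) →* R) T).coeff μ *
        ((Nat.card 𝓀[K] ^ (2 * symplecticRhoPairing μ).toNat : ℕ) : R) =
      ((isIwasawaExponent_symplectic hϖ).satakeTransform (1 : Multiplicative (Fin n → ℤ) →* R) T).coeff (-μ) *
        ((Nat.card 𝓀[K] ^ (-(2 * symplecticRhoPairing μ)).toNat : ℕ) : R) := by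
  classical
  have hT := heckeAlgebra.mem_span_range_doubleCosetOperator (symplecticInt (Fin n) K) T
  induction hT using Submodule.span_induction with
  | mem S hS =>
    obtain ⟨g, rfl⟩ := hS
    have hC := congrArg (Nat.cast : ℕ → R) (card_filter_symplecticIwasawaExp_mul_pow_eq hϖ g μ)
    push_cast at hC
    rw [(isIwasawaExponent_symplectic hϖ).coeff_satakeTransform_doubleCosetOperator,
      (isIwasawaExponent_symplectic hϖ).coeff_satakeTransform_doubleCosetOperator, MonoidHom.one_apply, MonoidHom.one_apply,
      mul_one, mul_one]
    push_cast
    exact hC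
  | zero => simp
  | add S S' _ _ hS hS' =>
    rw [map_add, AddMonoidAlgebra.coeff_add, Finsupp.add_apply, Finsupp.add_apply, add_mul, add_mul, hS, hS']
  | smul r S _ hS =>
    rw [map_smul, AddMonoidAlgebra.coeff_smul, Finsupp.smul_apply, Finsupp.smul_apply, smul_mul_assoc, smul_mul_assoc, hS]

end Counting

end Literature.NumberTheory.Automorphic.SymplecticCartan

end
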